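import Mathlib

/-!
# Route «KPlusLogSqLaw» — permutations of bandwidth one are products of disjoint adjacent transpositions

HONEST FRAMING.  Helper toward the crux `WeakLifting` (item `stmt-ValiantsHypothesis-19561`, route `KPlusLogSqLaw`, cell
`pub-symmetroid`, seat val-sym-lift-p3 g6, 2026-08-27) on the D2 line of its lineage (K = 4 rung of the aside `Lifting`): the live
residue of the rotation route (HOME/val-sym-lift-p1/g7/K4-JOINT-OBSTRUCTION-DIGEST.md §3c) asks for BANDED two-digit dominant chains,
i.e. chains all of whose permutations `σ` satisfy `|σ u − u| ≤ B`.  This file records the elementary structure of the first case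
`B = 1` (non-cyclic band): such a permutation is an INVOLUTION moving each point by at most one, i.e. a product of disjoint ADJACENT
transpositions `(u u+1)` (`BandOne.sq_eq_self`, `BandOne.swap_succ`, `BandOne.swap_pred`) — so a bandwidth-one term of a dominance
design is a matching of the path on the columns together with a class map, and a bandwidth-one dominant chain is a parametric
longest path in the width-two «Fibonacci ladder» (the trellis of HOME/val-sym-lift-p3/g6/FOLD-LEMMA-AND-WIDTH2-TRELLIS-liftp3g6.md §B;
its static case is the path model of `…Theorems.KPlusLogSqLaw.StaticPathFold`).  A statement about permutations of `Fin m` only;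
nothing here asserts anything about `WeakLifting`, `TropicalB`, `Lifting`, `MatrixDescartes` (stmt-ValiantsHypothesis-18050) or `VP ≠ VNP`.
-/

set_option linter.dupNamespace false
set_option autoImplicit false

namespace Summit.ValiantsHypothesis.ValiantsHypothesis.Theorems.KPlusLogSqLaw

namespace BandOne

variable {m : ℕ}

/-- the inverse of a bandwidth-one permutation has bandwidth one. [folklore] -/
theorem band_symm {σ : Equiv.Perm (Fin m)} (h : ∀ u : Fin m, (σ u : ℕ) ≤ u + 1 ∧ (u : ℕ) ≤ σ u + 1) (u : Fin m) :
    (σ.symm u : ℕ) ≤ u + 1 ∧ (u : ℕ) ≤ σ.symm u + 1 := by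
  have h1 := h (σ.symm u)
  rw [Equiv.apply_symm_apply] at h1
  exact ⟨h1.2, h1.1⟩

/-- no «right shift of two consecutive points»: `σ u = u + 1` and `σ (u+1) = u + 2` (as values) is impossible under bandwidth
one — the shift would have to propagate down to `0`, which then has no preimage. [folklore] -/
theorem not_two_step {σ : Equiv.Perm (Fin m)} (h : ∀ u : Fin m, (σ u : ℕ) ≤ u + 1 ∧ (u : ℕ) ≤ σ u + 1) :
    ∀ k : ℕ, ∀ u v : Fin m, (u : ℕ) = k → (v : ℕ) = k + 1 → (σ u : ℕ) = k + 1 → (σ v : ℕ) ≠ k + 2 := by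
  intro k
  induction k with
  | zero =>
    intro u v hu hv hσu hσv
    -- the preimage `w` of `u` (value 0) moves by at most one, so `w ∈ {u, v}`; both are excluded
    have hwb := band_symm h u
    rw [hu] at hwb
    have hσw : σ (σ.symm u) = u := Equiv.apply_symm_apply σ u
    have hwle : (σ.symm u : ℕ) ≤ 1 := by omega
    rcases Nat.le_one_iff_eq_zero_or_eq_one.mp hwle with h0 | h1
    · have he : σ.symm u = u := Fin.ext (by rw [h0, hu])
      rw [he] at hσw
      have := congrArg Fin.val hσw
      omega
    · have he : σ.symm u = v := Fin.ext (by rw [h1, hv])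
      rw [he] at hσw
      have := congrArg Fin.val hσw
      omega
  | succ k ih =>
    intro u v hu hv hσu hσv
    -- the preimage `w` of `u` (value k+1) has value in {k, k+1, k+2}; `u ↦ k+2` and `v ↦ k+3` exclude `k+1`, `k+2`,
    -- so `w` has value `k` and maps to `k+1`: together with `u ↦ k+2` this contradicts the induction hypothesis
    have hwb := band_symm h u
    rw [hu] at hwb
    have hσw : σ (σ.symm u) = u := Equiv.apply_symm_apply σ u
    have hwu : σ.symm u ≠ u := by
      intro he; rw [he] at hσw; have := congrArg Fin.val hσw; omega
    have hwv : σ.symm u ≠ v := by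
      intro he; rw [he] at hσw; have := congrArg Fin.val hσw; omega
    have hwk : (σ.symm u : ℕ) = k := by
      have h1 : (σ.symm u : ℕ) ≠ k + 1 := fun he => hwu (Fin.ext (by rw [he, hu]))
      have h2 : (σ.symm u : ℕ) ≠ k + 2 := fun he => hwv (Fin.ext (by rw [he, hv]))
      omega
    exact ih (σ.symm u) u hwk hu (by rw [hσw, hu]) hσu

/-- **a point moved up is swapped with its successor**: `σ u = u + 1 ⇒ σ (σ u) = u`. [folklore] -/
theorem swap_succ {σ : Equiv.Perm (Fin m)} (h : ∀ u : Fin m, (σ u : ℕ) ≤ u + 1 ∧ (u : ℕ) ≤ σ u + 1) (u : Fin m)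
    (hu : (σ u : ℕ) = u + 1) : σ (σ u) = u := by
  have hb := h (σ u)
  rw [hu] at hb
  -- `σ (σ u)` has value in {u, u+1, u+2}; `u+1` contradicts injectivity, `u+2` contradicts `not_two_step`
  have h1 : (σ (σ u) : ℕ) ≠ u + 1 := by
    intro he
    have h3 : σ (σ u) = σ u := Fin.ext (by rw [he, hu])
    have h4 := congrArg Fin.val (σ.injective h3)
    omega
  have h2 : (σ (σ u) : ℕ) ≠ (u : ℕ) + 2 := not_two_step h u u (σ u) rfl hu hu
  exact Fin.ext (by omega)

/-- **a point moved down is swapped with its predecessor**: `σ u + 1 = u ⇒ σ (σ u) = u`. [folklore] -/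
theorem swap_pred {σ : Equiv.Perm (Fin m)} (h : ∀ u : Fin m, (σ u : ℕ) ≤ u + 1 ∧ (u : ℕ) ≤ σ u + 1) (u : Fin m)
    (hu : (σ u : ℕ) + 1 = u) : σ (σ u) = u := by
  -- `σ.symm` has bandwidth one and moves `σ u` up by one, so `σ.symm (σ.symm (σ u)) = σ u`, i.e. `σ.symm u = σ u`
  have hs := swap_succ (band_symm h) (σ u) (by rw [Equiv.symm_apply_apply]; omega)
  rw [Equiv.symm_apply_apply] at hs
  have h2 := congrArg σ hs
  rw [Equiv.apply_symm_apply] at h2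
  exact h2.symm

/-- **bandwidth-one permutations are involutions**: `σ (σ u) = u` for every `u`. [folklore] -/
theorem sq_eq_self {σ : Equiv.Perm (Fin m)} (h : ∀ u : Fin m, (σ u : ℕ) ≤ u + 1 ∧ (u : ℕ) ≤ σ u + 1) (u : Fin m) :
    σ (σ u) = u := by
  have hb := h u
  by_cases h0 : (σ u : ℕ) = u
  · have he : σ u = u := Fin.ext h0
    rw [he, he]
  · by_cases h1 : (σ u : ℕ) = u + 1
    · exact swap_succ h u h1
    · exact swap_pred h u (by omega)

/-- **structure of a moved point**: it is swapped with an ADJACENT point (the values differ by exactly one and the partner maps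
back). [folklore] -/
theorem adjacent_swap_of_ne {σ : Equiv.Perm (Fin m)} (h : ∀ u : Fin m, (σ u : ℕ) ≤ u + 1 ∧ (u : ℕ) ≤ σ u + 1) (u : Fin m)
    (hu : σ u ≠ u) : ((σ u : ℕ) = u + 1 ∨ (σ u : ℕ) + 1 = u) ∧ σ (σ u) = u := by
  refine ⟨?_, sq_eq_self h u⟩
  have hb := h u
  have h0 : (σ u : ℕ) ≠ u := fun he => hu (Fin.ext he)
  omega

/-- the partner of an «opener» `u ↦ u + 1` is the next column: `σ (u+1) = u`. [folklore] -/
theorem eq_of_opener {σ : Equiv.Perm (Fin m)} (h : ∀ u : Fin m, (σ u : ℕ) ≤ u + 1 ∧ (u : ℕ) ≤ σ u + 1) (u v : Fin m)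
    (hu : (σ u : ℕ) = u + 1) (hv : (v : ℕ) = u + 1) : σ v = u := by
  have he : v = σ u := Fin.ext (by rw [hv, hu])
  rw [he]
  exact swap_succ h u hu

end BandOne

end Summit.ValiantsHypothesis.ValiantsHypothesis.Theorems.KPlusLogSqLaw
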